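import Summits.QuantumFields.YangMills.Theorems.UnitScaleTiltProp8ChartDoubleBarOneStep
import Literature.MathematicalPhysics.QuantumFieldTheory.Balaban1983to89.BlockAveragingEMLAnalyticMean
import Literature.MathematicalPhysics.QuantumFieldTheory.Balaban1983to89.BlockAveragingTwoLevel
import HarnessLib

/-!
# Line H (`BirthV10.stub_halvingStep`, stmt-QuantumFields-19200) — LEMMA B-al-2, brick (B-iii), CORE: transports and `exp[mean log]` are Lipschitz in the field
# ([Balaban1985Averaging] (9)∕(62), [Balaban1987RG1] (0.4)) — the generic half of the double-bar Lipschitz estimate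

Cell `ym3-torus` (HUMAN RULING D-0037: YM₃ on T³ is ladder rung R3 — NOT d = 4, NOT infinite volume, NOT a mass gap, NOT the Clay problem), width seat `ym-ust-19200-w3` gen 10
(LEAD-H ★w5-19200 g7 WORD 10 (2): LEMMA B-al ≡ (N1); SIGNATURE B-al-2 v1 cea012fa, brick (B-iii)).  `--supports stmt-QuantumFields-19200 --as helper`; THEOREMS ONLY (0 `def`,
0 `sorry`); count-neutral; nothing here claims B-al-2, `H42topCrossT`, (M2′), the stub, the crux or the gap.

WHAT.  For two `𝔸ˣ`-fields `W, W′` on `T^{(j)}` that are `s`-close to `1` and `ρ`-close to EACH OTHER on the bonds of the two blocks of the coarse bond `c`: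
* §1 `norm_holT_sub_holT_le` — transports along a word of length `m` differ by `≤ m(1+2s)^{m+1}ρ`;
* §2 `norm_eml_sub_eml_le` — the printed `exp[mean log]` is `(1 + 144t)`-Lipschitz on the polydisc `‖U − 1‖ ≤ t ≤ 1∕24` (sharp constant `1` at the identity, from the
  tree's `C′_M = 144` ✓`BlockAveragingEMLAnalyticMean.norm_fderiv_eml_sub_mean_le` and the mean value inequality on the convex polydisc);
* §3 generic algebra for the assembly (`norm_triple_sub_triple_le`, `norm_mul_sub_mul_le'`, `norm_inv_sub_inv_le`, `one_add_pow_le_one_add_two_mul`, `norm_assembly_le`);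
  the double-bar estimate itself (`‖U̿(W)(c)⁻¹·U̿(W′)(c) − 1‖ ≤ 2(ℓ + L + 2m)ρ`) is the companion file `UnitScaleTiltHalvingDbarLipschitz`.
HONEST SCOPE.  Generic Lipschitz lemmas; nothing of the level induction is here.

References: T. Bałaban, CMP **98** (1985) 17–51 [Balaban1985Averaging] ((62) p.28, (89) p.31, Prop. 3 (122)–(125) p.36); CMP **109** (1987) 249–301 [Balaban1987RG1]
((0.3)–(0.4) pp.252–253).
-/

set_option autoImplicit false

noncomputable section

open scoped BigOperators
open NormedSpace

namespace Summit.QuantumFields.YangMills.Theorems.HalvingDbarLipschitzCore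

open Literature.MathematicalPhysics.QuantumFieldTheory.Balaban1983to89
open T4Continuum BlockAveraging AveragingRT ExpMeanLog MatrixLog BlockAveragingEMLLinearised
open B10Eq27TorusAxialLog (holT holT_nil holT_cons_true holT_cons_false)
open B7TransferAnalyticMean (meanCLM meanCLM_apply norm_meanCLM_apply_le)
open BlockAveragingEMLAnalyticMean (norm_fderiv_eml_sub_mean_le isAnalyticMean_eml)
open T4Continuum (blockOf_ends_of_mem_stairWalk)
open LatticeWordStokes (length_loopWord_le length_stairWord_le)
open Summit.QuantumFields.YangMills.Theorems.Prop8Chart (loopHolU emlAvgU coe_emlAvgU norm_holT_sub_one_sub_walkSum_le_of_steps norm_holT_sub_one_sub_walkSum_le_of_length_le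
  norm_inv_sub_one_le_two_mul two_block_of_mem_loopWalk two_block_of_mem_lineWalk norm_loopHolU_sub_one_le)
open Summit.QuantumFields.YangMills.Theorems.Prop8ChartDoubleBar (vframeU dbarAvgU coe_dbarAvgU coe_vframeU norm_vframeU_sub_one_le norm_dbarAvgU_sub_one_le norm_holT_stair_sub_one_le)

variable {P : Params} {j : ℕ}
variable {𝔸 : Type*} [NormedRing 𝔸] [NormedAlgebra ℂ 𝔸] [CompleteSpace 𝔸] [NormOneClass 𝔸]

/-! ## §1 Transports along a word are Lipschitz in the field -/

omit [NormedAlgebra ℂ 𝔸] [CompleteSpace 𝔸] in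
/-- **TRANSPORT PERTURBATION.**  If on every bond of the walk both fields are within `s ≤ ½` of `1` and within `ρ` of each other, then
`‖W′(Γ) − W(Γ)‖ ≤ |Γ|·(1+2s)^{|Γ|+1}·ρ` (each step factor `W(b)^{±1}` has norm `≤ 1+2s` and moves by `≤ (1+2s)²ρ`). [cite: Balaban1985Averaging, (9) p.18, (122) p.36] -/
theorem norm_holT_sub_holT_le {W W' : GaugeField P j 𝔸ˣ} {s ρ : ℝ} (hs0 : 0 ≤ s) (hs : s ≤ 1 / 2) (hρ0 : 0 ≤ ρ) :
    ∀ (w : List (Letter P.d)) (x : Site P j),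
      (∀ st ∈ walk x w, ‖((W st.bond : 𝔸ˣ) : 𝔸) - 1‖ ≤ s ∧ ‖((W' st.bond : 𝔸ˣ) : 𝔸) - 1‖ ≤ s ∧ ‖((W' st.bond : 𝔸ˣ) : 𝔸) - W st.bond‖ ≤ ρ) →
      ‖((holT W' x w : 𝔸ˣ) : 𝔸) - holT W x w‖ ≤ w.length * ((1 + 2 * s) ^ (w.length + 1) * ρ)
  | [], x, _ => by simp
  | (μ, fwd) :: w, x, h => by
    -- one step: `f′T′ − fT = (f′ − f)T′ + f(T′ − T)`
    have key : ∀ (f f' T T' : 𝔸) (n : ℕ), ‖f - 1‖ ≤ 2 * s → ‖f' - f‖ ≤ (1 + 2 * s) ^ 2 * ρ → ‖T' - 1‖ ≤ (1 + 2 * s) ^ n - 1 →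
        ‖T' - T‖ ≤ n * ((1 + 2 * s) ^ (n + 1) * ρ) → ‖f' * T' - f * T‖ ≤ ((n + 1 : ℕ) : ℝ) * ((1 + 2 * s) ^ (n + 1 + 1) * ρ) := by
      intro f f' T T' n hf hff hT hTT
      have hfn : ‖f‖ ≤ 1 + 2 * s := by
        have := norm_le_norm_add_norm_sub' f 1; rw [norm_one] at this; linarith
      have hTn : ‖T'‖ ≤ (1 + 2 * s) ^ n := by
        have := norm_le_norm_add_norm_sub' T' 1; rw [norm_one] at this; linarith
      have e : f' * T' - f * T = (f' - f) * T' + f * (T' - T) := by noncomm_ring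
      rw [e]
      have hq : (0 : ℝ) ≤ (1 + 2 * s) := by linarith
      calc _ ≤ ‖f' - f‖ * ‖T'‖ + ‖f‖ * ‖T' - T‖ := (norm_add_le _ _).trans (add_le_add (norm_mul_le _ _) (norm_mul_le _ _))
        _ ≤ ((1 + 2 * s) ^ 2 * ρ) * (1 + 2 * s) ^ n + (1 + 2 * s) * (n * ((1 + 2 * s) ^ (n + 1) * ρ)) := by
            gcongr
        _ = ((n + 1 : ℕ) : ℝ) * ((1 + 2 * s) ^ (n + 1 + 1) * ρ) := by push_cast; ring
    cases fwd with
    | true =>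
      obtain ⟨hb, hb', hd⟩ := h ⟨⟨x, μ⟩, true⟩ (by simp [walk])
      have hrest : ∀ st ∈ walk (x.shift μ) w, ‖((W st.bond : 𝔸ˣ) : 𝔸) - 1‖ ≤ s ∧ ‖((W' st.bond : 𝔸ˣ) : 𝔸) - 1‖ ≤ s ∧
          ‖((W' st.bond : 𝔸ˣ) : 𝔸) - W st.bond‖ ≤ ρ := fun st hst => h st (by simp [walk, hst])
      have ih := norm_holT_sub_holT_le hs0 hs hρ0 w (x.shift μ) hrest
      have hT' := (norm_holT_sub_one_sub_walkSum_le_of_steps (S := W') hs0 hs w (x.shift μ) fun st hst => (hrest st hst).2.1).1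
      have hd' : ‖((W' ⟨x, μ⟩ : 𝔸ˣ) : 𝔸) - W ⟨x, μ⟩‖ ≤ (1 + 2 * s) ^ 2 * ρ := by
        refine hd.trans ?_
        have h1 : (1 : ℝ) ≤ (1 + 2 * s) ^ 2 := by nlinarith
        nlinarith
      have hk := key ((W ⟨x, μ⟩ : 𝔸ˣ) : 𝔸) ((W' ⟨x, μ⟩ : 𝔸ˣ) : 𝔸) ((holT W (x.shift μ) w : 𝔸ˣ) : 𝔸) ((holT W' (x.shift μ) w : 𝔸ˣ) : 𝔸)
        w.length (hb.trans (by linarith)) hd' hT' ih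
      simpa only [holT_cons_true, Units.val_mul, List.length_cons] using hk
    | false =>
      obtain ⟨hb, hb', hd⟩ := h ⟨⟨x.unshift μ, μ⟩, false⟩ (by simp [walk])
      have hrest : ∀ st ∈ walk (x.unshift μ) w, ‖((W st.bond : 𝔸ˣ) : 𝔸) - 1‖ ≤ s ∧ ‖((W' st.bond : 𝔸ˣ) : 𝔸) - 1‖ ≤ s ∧
          ‖((W' st.bond : 𝔸ˣ) : 𝔸) - W st.bond‖ ≤ ρ := fun st hst => h st (by simp [walk, hst])
      have ih := norm_holT_sub_holT_le hs0 hs hρ0 w (x.unshift μ) hrest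
      have hT' := (norm_holT_sub_one_sub_walkSum_le_of_steps (S := W') hs0 hs w (x.unshift μ) fun st hst => (hrest st hst).2.1).1
      -- the inverse step: `‖u′⁻¹ − u⁻¹‖ = ‖u′⁻¹(u − u′)u⁻¹‖ ≤ (1+2s)²ρ`
      set u : 𝔸ˣ := W ⟨x.unshift μ, μ⟩
      set u' : 𝔸ˣ := W' ⟨x.unshift μ, μ⟩
      have hinv : ‖((u'⁻¹ : 𝔸ˣ) : 𝔸) - ((u⁻¹ : 𝔸ˣ) : 𝔸)‖ ≤ (1 + 2 * s) ^ 2 * ρ := by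
        have e : ((u'⁻¹ : 𝔸ˣ) : 𝔸) - ((u⁻¹ : 𝔸ˣ) : 𝔸) = ((u'⁻¹ : 𝔸ˣ) : 𝔸) * ((u : 𝔸) - (u' : 𝔸)) * ((u⁻¹ : 𝔸ˣ) : 𝔸) := by
          rw [mul_sub, sub_mul, Units.mul_inv_cancel_right, Units.inv_mul, one_mul]
        have h1 : ‖((u'⁻¹ : 𝔸ˣ) : 𝔸)‖ ≤ 1 + 2 * s := by
          have := norm_le_norm_add_norm_sub' ((u'⁻¹ : 𝔸ˣ) : 𝔸) 1; rw [norm_one] at this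
          linarith [norm_inv_sub_one_le_two_mul hb' hs]
        have h2 : ‖((u⁻¹ : 𝔸ˣ) : 𝔸)‖ ≤ 1 + 2 * s := by
          have := norm_le_norm_add_norm_sub' ((u⁻¹ : 𝔸ˣ) : 𝔸) 1; rw [norm_one] at this
          linarith [norm_inv_sub_one_le_two_mul hb hs]
        rw [e]
        calc _ ≤ ‖((u'⁻¹ : 𝔸ˣ) : 𝔸)‖ * ‖(u : 𝔸) - (u' : 𝔸)‖ * ‖((u⁻¹ : 𝔸ˣ) : 𝔸)‖ :=
              (norm_mul_le _ _).trans (mul_le_mul_of_nonneg_right (norm_mul_le _ _) (norm_nonneg _))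
          _ ≤ (1 + 2 * s) * ρ * (1 + 2 * s) := by
              have hρ' : ‖(u : 𝔸) - (u' : 𝔸)‖ ≤ ρ := by rw [norm_sub_rev]; exact hd
              gcongr
          _ = (1 + 2 * s) ^ 2 * ρ := by ring
      have hk := key ((u⁻¹ : 𝔸ˣ) : 𝔸) ((u'⁻¹ : 𝔸ˣ) : 𝔸) ((holT W (x.unshift μ) w : 𝔸ˣ) : 𝔸) ((holT W' (x.unshift μ) w : 𝔸ˣ) : 𝔸)
        w.length (norm_inv_sub_one_le_two_mul hb hs) hinv hT' ih
      simpa only [holT_cons_false, Units.val_mul, List.length_cons] using hk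

omit [NormedAlgebra ℂ 𝔸] [CompleteSpace 𝔸] in
/-- The same with a length bound `|Γ| ≤ m`: `‖W′(Γ) − W(Γ)‖ ≤ m·(1+2s)^{m+1}·ρ`. [cite: Balaban1985Averaging, (9) p.18, (122) p.36] -/
theorem norm_holT_sub_holT_le_of_length_le {W W' : GaugeField P j 𝔸ˣ} {s ρ : ℝ} (hs0 : 0 ≤ s) (hs : s ≤ 1 / 2) (hρ0 : 0 ≤ ρ)
    {m : ℕ} (w : List (Letter P.d)) (x : Site P j) (hw : w.length ≤ m)
    (h : ∀ st ∈ walk x w, ‖((W st.bond : 𝔸ˣ) : 𝔸) - 1‖ ≤ s ∧ ‖((W' st.bond : 𝔸ˣ) : 𝔸) - 1‖ ≤ s ∧ ‖((W' st.bond : 𝔸ˣ) : 𝔸) - W st.bond‖ ≤ ρ) :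
    ‖((holT W' x w : 𝔸ˣ) : 𝔸) - holT W x w‖ ≤ m * ((1 + 2 * s) ^ (m + 1) * ρ) := by
  refine (norm_holT_sub_holT_le hs0 hs hρ0 w x h).trans ?_
  have h1 : (1 : ℝ) ≤ 1 + 2 * s := by linarith
  have hl : (w.length : ℝ) ≤ m := by exact_mod_cast hw
  have hp : (1 + 2 * s) ^ (w.length + 1) ≤ (1 + 2 * s) ^ (m + 1) := pow_le_pow_right₀ h1 (by omega)
  have hp0 : 0 ≤ (1 + 2 * s) ^ (w.length + 1) := by positivity
  calc _ ≤ (m : ℝ) * ((1 + 2 * s) ^ (w.length + 1) * ρ) := mul_le_mul_of_nonneg_right hl (by positivity)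
    _ ≤ (m : ℝ) * ((1 + 2 * s) ^ (m + 1) * ρ) := by gcongr

/-! ## §2 `exp[mean log]` is `(1 + 144t)`-Lipschitz on the polydisc of radius `t ≤ 1∕24` -/

section Eml

variable {ι : Type*} [Fintype ι]

omit [NormOneClass 𝔸] in
/-- **SHARP LIPSCHITZ CONSTANT OF `eml` NEAR THE IDENTITY**: `‖eml U′ − eml U‖ ≤ (1 + 144·t)·‖U′ − U‖` for `‖U − 1‖, ‖U′ − 1‖ ≤ t ≤ 1∕24` — the derivative is the
arithmetic mean up to `144·t·‖·‖` (✓`norm_fderiv_eml_sub_mean_le`) and the polydisc is convex. [cite: Balaban1987RG1, (0.4)-(0.8) p.253] -/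
theorem norm_eml_sub_eml_le {U U' : ι → 𝔸} {t : ℝ} (hU : ‖U - 1‖ ≤ t) (hU' : ‖U' - 1‖ ≤ t) (ht : t ≤ 1 / 24) :
    ‖eml U' - eml U‖ ≤ (1 + 144 * t) * ‖U' - U‖ := by
  have ht0 : 0 ≤ t := (norm_nonneg _).trans hU
  set K : Set (ι → 𝔸) := Metric.closedBall (1 : ι → 𝔸) t with hK
  have hconv : Convex ℝ K := convex_closedBall _ _
  have hmem : ∀ {V : ι → 𝔸}, ‖V - 1‖ ≤ t → V ∈ K := fun hV => by rwa [hK, Metric.mem_closedBall, dist_eq_norm]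
  have hdiff : ∀ V ∈ K, DifferentiableAt ℂ (eml : (ι → 𝔸) → 𝔸) V := fun V hV => by
    refine ((isAnalyticMean_eml (ι := ι) (𝔸 := 𝔸)).analyticOnNhd V ?_).differentiableAt
    rw [Metric.mem_ball]; rw [hK, Metric.mem_closedBall] at hV; linarith
  have hbound : ∀ V ∈ K, ‖fderiv ℂ (eml : (ι → 𝔸) → 𝔸) V - meanCLM ι 𝔸‖ ≤ 144 * t := fun V hV => by
    have hV' : ‖V - 1‖ ≤ t := by rwa [hK, Metric.mem_closedBall, dist_eq_norm] at hV
    refine ContinuousLinearMap.opNorm_le_bound _ (by positivity) fun X => ?_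
    rw [show (fderiv ℂ (eml : (ι → 𝔸) → 𝔸) V - meanCLM ι 𝔸) X = fderiv ℂ (eml : (ι → 𝔸) → 𝔸) V X - meanCLM ι 𝔸 X from rfl]
    calc _ ≤ 144 * ‖X‖ * ‖V - 1‖ := norm_fderiv_eml_sub_mean_le (hV'.trans ht) X
      _ ≤ 144 * t * ‖X‖ := by nlinarith [norm_nonneg X, norm_nonneg (V - 1)]
  have h := hconv.norm_image_sub_le_of_norm_fderiv_le' hdiff hbound (hmem hU) (hmem hU')
  have hmean : ‖meanCLM ι 𝔸 (U' - U)‖ ≤ ‖U' - U‖ := norm_meanCLM_apply_le _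
  have e : eml U' - eml U = (eml U' - eml U - meanCLM ι 𝔸 (U' - U)) + meanCLM ι 𝔸 (U' - U) := by abel
  rw [e]
  calc _ ≤ 144 * t * ‖U' - U‖ + ‖U' - U‖ := norm_add_le_of_le h hmean
    _ = (1 + 144 * t) * ‖U' - U‖ := by ring

end Eml

/-! ## §3 Generic algebra for the assembly -/

section DoubleBar

omit [NormOneClass 𝔸] [NormedAlgebra ℂ 𝔸] [CompleteSpace 𝔸] in
/-- Telescoping a triple product: `‖a′x′b′ − axb‖ ≤ ‖a′ − a‖‖x′‖‖b′‖ + ‖a‖‖x′ − x‖‖b′‖ + ‖a‖‖x‖‖b′ − b‖`. [folklore] -/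
theorem norm_triple_sub_triple_le (a a' x x' b b' : 𝔸) :
    ‖a' * x' * b' - a * x * b‖ ≤ ‖a' - a‖ * ‖x'‖ * ‖b'‖ + ‖a‖ * ‖x' - x‖ * ‖b'‖ + ‖a‖ * ‖x‖ * ‖b' - b‖ := by
  have e : a' * x' * b' - a * x * b = (a' - a) * x' * b' + a * (x' - x) * b' + a * x * (b' - b) := by noncomm_ring
  rw [e]
  refine (norm_add_le _ _).trans (add_le_add ((norm_add_le _ _).trans (add_le_add ?_ ?_)) ?_)
  · exact (norm_mul_le _ _).trans (mul_le_mul_of_nonneg_right (norm_mul_le _ _) (norm_nonneg _))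
  · exact (norm_mul_le _ _).trans (mul_le_mul_of_nonneg_right (norm_mul_le _ _) (norm_nonneg _))
  · exact (norm_mul_le _ _).trans (mul_le_mul_of_nonneg_right (norm_mul_le _ _) (norm_nonneg _))

omit [NormOneClass 𝔸] [NormedAlgebra ℂ 𝔸] [CompleteSpace 𝔸] in
/-- `‖x′y′ − xy‖ ≤ ‖x′ − x‖‖y′‖ + ‖x‖‖y′ − y‖`. [folklore] -/
theorem norm_mul_sub_mul_le' (x x' y y' : 𝔸) : ‖x' * y' - x * y‖ ≤ ‖x' - x‖ * ‖y'‖ + ‖x‖ * ‖y' - y‖ := by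
  have e : x' * y' - x * y = (x' - x) * y' + x * (y' - y) := by noncomm_ring
  rw [e]
  exact (norm_add_le _ _).trans (add_le_add (norm_mul_le _ _) (norm_mul_le _ _))

omit [NormOneClass 𝔸] [NormedAlgebra ℂ 𝔸] [CompleteSpace 𝔸] in
/-- `‖u′⁻¹ − u⁻¹‖ ≤ ‖u′⁻¹‖·‖u′ − u‖·‖u⁻¹‖` for units. [folklore] -/
theorem norm_inv_sub_inv_le (u u' : 𝔸ˣ) :
    ‖((u'⁻¹ : 𝔸ˣ) : 𝔸) - ((u⁻¹ : 𝔸ˣ) : 𝔸)‖ ≤ ‖((u'⁻¹ : 𝔸ˣ) : 𝔸)‖ * ‖(u' : 𝔸) - u‖ * ‖((u⁻¹ : 𝔸ˣ) : 𝔸)‖ := by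
  have e : ((u'⁻¹ : 𝔸ˣ) : 𝔸) - ((u⁻¹ : 𝔸ˣ) : 𝔸) = ((u'⁻¹ : 𝔸ˣ) : 𝔸) * ((u : 𝔸) - (u' : 𝔸)) * ((u⁻¹ : 𝔸ˣ) : 𝔸) := by
    rw [mul_sub, sub_mul, Units.mul_inv_cancel_right, Units.inv_mul, one_mul]
  rw [e, norm_sub_rev ((u' : 𝔸ˣ) : 𝔸)]
  exact (norm_mul_le _ _).trans (mul_le_mul_of_nonneg_right (norm_mul_le _ _) (norm_nonneg _))

/-- `(1 + b)^n ≤ 1 + 2nb` for `0 ≤ b`, `nb ≤ 1` (`(1+b)^n ≤ e^{nb} ≤ 1 + nb + (nb)²`). [folklore] -/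
theorem one_add_pow_le_one_add_two_mul {b : ℝ} (hb : 0 ≤ b) {n : ℕ} (hnb : (n : ℝ) * b ≤ 1) : (1 + b) ^ n ≤ 1 + 2 * (n * b) := by
  have h1 : (1 + b) ^ n ≤ Real.exp ((n : ℝ) * b) := by
    calc (1 + b) ^ n ≤ (Real.exp b) ^ n := pow_le_pow_left₀ (by linarith) (by linarith [Real.add_one_le_exp b]) n
      _ = Real.exp ((n : ℝ) * b) := by rw [← Real.exp_nat_mul]
  have hx0 : 0 ≤ (n : ℝ) * b := by positivity
  have h2 := Real.abs_exp_sub_one_sub_id_le (x := (n : ℝ) * b) (by rw [abs_of_nonneg hx0]; exact hnb)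
  have h3 : Real.exp ((n : ℝ) * b) ≤ 1 + (n : ℝ) * b + ((n : ℝ) * b) ^ 2 := by
    have := (abs_le.mp h2).2; linarith
  nlinarith

/-- `(1 + 2s)^{n+1} ≤ 21∕20` once `(n+1)·2s ≤ 10⁻³`. [folklore] -/
theorem one_add_two_mul_pow_le {s : ℝ} (hs0 : 0 ≤ s) {n : ℕ} (hn : ((n + 1 : ℕ) : ℝ) * (2 * s) ≤ 1 / 1000) : (1 + 2 * s) ^ (n + 1) ≤ 21 / 20 :=
  (one_add_pow_le_one_add_two_mul (by linarith) (hn.trans (by norm_num))).trans (by linarith)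

omit [NormOneClass 𝔸] [NormedAlgebra ℂ 𝔸] [CompleteSpace 𝔸] in
/-- **NUMERIC ASSEMBLY** of `D⁻¹·(a′x′b′ − axb)` with all factors within `101∕100` and the three differences of sizes `6∕5·m·ρ`, `6∕5·q·ρ`, `112∕100·m·ρ`:
the product is within `2·(q + 2m)·ρ`. [folklore] -/
theorem norm_assembly_le {Dinv a a' x x' b b' : 𝔸} {m q ρ : ℝ} (hm : 0 ≤ m) (hq : 0 ≤ q) (hρ : 0 ≤ ρ)
    (hDinv : ‖Dinv‖ ≤ 101 / 100) (ha : ‖a‖ ≤ 101 / 100) (hx : ‖x‖ ≤ 101 / 100) (hx' : ‖x'‖ ≤ 101 / 100) (hb' : ‖b'‖ ≤ 101 / 100)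
    (hda : ‖a' - a‖ ≤ 6 / 5 * m * ρ) (hdx : ‖x' - x‖ ≤ 6 / 5 * q * ρ) (hdb : ‖b' - b‖ ≤ 112 / 100 * m * ρ) :
    ‖Dinv * (a' * x' * b' - a * x * b)‖ ≤ 2 * (q + 2 * m) * ρ := by
  have h3 := norm_triple_sub_triple_le a a' x x' b b'
  have hdiff : ‖a' * x' * b' - a * x * b‖ ≤ 3 / 2 * (q + 2 * m) * ρ := by
    refine h3.trans ?_
    calc _ ≤ (6 / 5 * m * ρ) * (101 / 100) * (101 / 100) + (101 / 100) * (6 / 5 * q * ρ) * (101 / 100) + (101 / 100) * (101 / 100) * (112 / 100 * m * ρ) := by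
          gcongr
      _ ≤ 3 / 2 * (q + 2 * m) * ρ := by nlinarith [mul_nonneg hm hρ, mul_nonneg hq hρ]
  refine (norm_mul_le _ _).trans ?_
  calc _ ≤ (101 / 100) * (3 / 2 * (q + 2 * m) * ρ) := by gcongr
    _ ≤ 2 * (q + 2 * m) * ρ := by nlinarith [mul_nonneg (add_nonneg hq (mul_nonneg zero_le_two hm)) hρ]

end DoubleBar

end Summit.QuantumFields.YangMills.Theorems.HalvingDbarLipschitzCore

end
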